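import Summits.Ventures.LatticeQCDFlow.Scaling.BooleanStarSmallPoolLaw
import Summits.Ventures.LatticeQCDFlow.Scaling.BooleanStarMacroscopicPoolLaw

/-!
HONEST FRAMING: exact (Metropolis-corrected) sampling algorithms for lattice gauge theory; figures
of merit are autocorrelation/cost numbers at stated couplings and volumes; no continuum-physics
claim.

# BooleanStarLawFreeOrder — OPEN-MATH ITEM 1 (ii) FOR THE HOMOGENEOUS BOOLEAN STAR, CLOSED: FOR EVERY LAW, EVERY `K` AND EVERY `t/h`,
# `t_mix(ε) ≤ ⌈(4/(hρ))·log((3eK+1)/ε)⌉`, `ρ = (1/192)·p·(t/K)/(h+2t)`, `p = μ_0(b) + μ_0(b̄)·rr` — THE CONJECTURED LAW-FREE ORDER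
# `K/(p·min{t,h})·log(K/ε)` UP TO AN ABSOLUTE CONSTANT, WITH NO HYPOTHESIS BEYOND THE MODEL (lean-2 GEN-33, ours)

Venture-side (OURS).  Cell `lqcd-flow` (pub-lqcd), unit `pub-lqcd-lean-2-g33`, 2026-08-29.  Chapter T, file 4: the three one-dimensional legs of this chapter combined
through S11 `boolStar_mixingTime_le_of_oneCopyDrift_int`.  Homogeneous Boolean star = the map-assisted tempering hub `t·GSw + (1−t)·Π_w^M` of chapter P with a
persistent hub (exact redraws, weight `w_0`), `K` idle cold levels of one common law `μ_1`, identity maps, a uniform entry list, Boolean contents; `b` the content the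
cold law likes (`μ_0(b)μ_1(b̄) ≤ μ_0(b̄)μ_1(b)`), `rr = μ_0(b)μ_1(b̄)/(μ_0(b̄)μ_1(b)) ∈ [0,1]` the acceptance of the disliked move, `p = μ_0(b) + μ_0(b̄)rr` the hub
domination constant, `h = (1−t)w_0`.

* **`boolStar_mixingTime_le_lawFree`** (and `…'` with the constant pulled out, `halfBoolStar_mixingTime_le_lawFree` the half-swap card `⌈(4608K/p)·log((3eK+1)/ε)⌉₊`) —
  **`t_mix(ε) ≤ ⌈(4/(hρ))·log((3eK+1)/ε)⌉₊`, `ρ = p·(t/K)/(192(h+2t))`**, for every law, `K ≥ 1`, `0 < t < 1`, `w_0 > 0`,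
  `ε > 0`.  Proof: three regimes, one potential each, all at the common rate `ρ` (the drift inequality is monotone in the rate):
  - `rr ≥ μ_0(b)` (weak drift): `φ ≡ 0`, rate `c(ph + rr t)/(h+2t)² ≥ pc/(4(h+2t))` since `p ≤ 2rr` (T0 `oneCopyDrift_zero`);
  - `μ_0(b̄)rrK ≤ μ_0(b)/2` (small pool): `φ = max{x,0}`, rate `μ_0(b)c/(2(h+2t)) ≥ pc/(3(h+2t))` since `p ≤ 3μ_0(b)/2` (T0 `oneCopyDrift_smallPool`);
  - `rr ≤ μ_0(b)`, `μ_0(b̄)rrK ≥ μ_0(b)/2` (macroscopic pool): the relative-drift potential of T1, rate `μ_0(b)c/(96(h+2t)) ≥ pc/(192(h+2t))` since `p ≤ 2μ_0(b)`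
    (T3 `oneCopyDrift_macroPool`).

So `hρ = (1/192)·p·min{t,h}/K·(h·max{…})`-free: `1/(hρ) = 192K(h+2t)/(p·h·t) ≤ 576·K/(p·min{t,h})`, i.e. **`t_mix(ε) = O((K/(p·min{t,h}))·log(K/ε))` uniformly in
the laws** — the conjectured order of OPEN-MATH-chapterM item 1 (ii) (lean-2/OPEN-MATH-chapterM.md), matching the two-sided `Θ((K/p)·log K)` of chapter O on the
witness family up to the absolute constant; no `|S|`, no least mass, no regime.  What this does NOT say: the constant `192` is an artefact of the crude closed-form
bounds (toy value of the same certificate `κ ≈ 0.75`, i.e. `≈ 1/1.3`, work-gen33/numerics; NOTHING CLAIMED); `q ≥ 3` contents, moving cold levels, sectors (items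
(i), (iii), (iv)) are untouched by this file.
NOT CLAIMED: anything measured; optimal constants.  Literature grade (cell rule): OWN, elementary; nothing cited as a fact; no new bib keys.
-/

noncomputable section

namespace Summit.Ventures.LatticeQCDFlow.Scaling

section Law
open Finset Function Matrix
open Literature.Probability.MarkovChains

variable {K m : ℕ} {μ : Fin (K + 1) → Bool → ℝ} {M : Fin (K + 1) → Bool → Bool → ℝ} {w : Fin (K + 1) → ℝ} {t : ℝ}
variable (κ : Fin m → Fin K)

/-- **THE COLD-START LAW OF THE HOMOGENEOUS BOOLEAN STAR, EVERY LAW, EVERY `K`, EVERY `t/h` — OPEN-MATH ITEM 1 (ii) CLOSED FOR `q = 2`.**  Homogeneous Boolean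
star (`m ≥ 1` uniform entries, `0 < t < 1`, `w_0 > 0`, positive laws, idle cold levels of one common law, exact hot redraws), liked content `b`
(`μ_0(b)μ_1(b̄) ≤ μ_0(b̄)μ_1(b)`), `rr = μ_0(b)μ_1(b̄)/(μ_0(b̄)μ_1(b))`, `p = μ_0(b) + μ_0(b̄)rr`, `h = (1−t)w_0`:
**`t_mix(ε) ≤ ⌈(4/(hρ))·log((3eK+1)/ε)⌉₊` with `ρ = p·(t/K)/(192(h + 2t))`** — `O((K/(p·min{t,h}))·log(K/ε))`, the conjectured law-free order, with no hypothesis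
beyond the model.  Three regimes (`rr ≥ μ_0(b)` ∕ small pool ∕ macroscopic pool), one potential each (T0, T0, T3), at the common rate `ρ`. [ours] -/
theorem boolStar_mixingTime_le_lawFree (hm : 1 ≤ m) (ht0 : 0 < t) (ht1 : t < 1) (hw0 : ∀ k, 0 ≤ w k) (hw00 : 0 < w 0)
    (hw1 : ∑ k, w k = 1) (hμ : ∀ k x, 0 < μ k x) (hμ1 : ∀ k, ∑ u, μ k u = 1) (hM0 : ∀ u v, M 0 u v = μ 0 v)
    (hidle : ∀ i : Fin K, ∀ u v, M i.succ u v = if v = u then 1 else 0) (hhom : ∀ i : Fin K, μ i.succ = μ 1)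
    {c0 : ℕ} (hunif : ∀ i : Fin K, (univ.filter fun r : Fin m => κ r = i).card = c0)
    {b : Bool} (hb : μ 0 b * μ 1 (!b) ≤ μ 0 (!b) * μ 1 b)
    {ε : ℝ} (hε : 0 < ε) :
    mixingTime (fun y z : Fin (K + 1) → Bool =>
        t * ptGraphSwap μ (fun r : Fin m => (((0 : Fin (K + 1)), (κ r).succ) : Fin (K + 1) × Fin (K + 1))) (fun _ : Fin m => Equiv.refl Bool) y z
          + (1 - t) * prodKernel w M y z) (tensorFun μ) ε
      ≤ ⌈1 / ((1 - t) * w 0 * ((μ 0 b + μ 0 (!b) * (μ 0 b * μ 1 (!b) / (μ 0 (!b) * μ 1 b))) * (t / K) / (192 * ((1 - t) * w 0 + 2 * t))) / 4)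
          * Real.log ((Real.exp 1 * (K + 2 * K) + 1) / ε)⌉₊ := by
  let rr : ℝ := μ 0 b * μ 1 (!b) / (μ 0 (!b) * μ 1 b)
  let πb : ℝ → ℝ := fun B => t / K * B / ((1 - t) * w 0 + t / K * B + t / K * rr * (K - B + 1))
  let πb' : ℝ → ℝ := fun B => t / K * (K - B) * rr / ((1 - t) * w 0 + t / K * (K - B) * rr + t / K * (B + 1))
  have hmK : (m : ℝ) = c0 * K := uniformList_card κ hunif
  have hK1n : 1 ≤ K := by
    have hK0 : K ≠ 0 := by
      intro h0; have : (m : ℝ) = 0 := by rw [hmK, h0]; simp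
      exact absurd (by exact_mod_cast this : m = 0) (by omega)
    exact Nat.one_le_iff_ne_zero.mpr hK0
  have hK1 : (1 : ℝ) ≤ K := by exact_mod_cast hK1n
  obtain ⟨-, hrr0, hrr1⟩ := boolStar_acc_disliked (acc := fun u v => min 1 (μ 0 v * μ 1 u / (μ 0 u * μ 1 v))) hμ (fun u v => rfl) hb (rr := rr) rfl
  have hh0 : 0 < (1 - t) * w 0 := mul_pos (by linarith) hw00
  have hc0 : 0 < t / K := div_pos ht0 (by linarith)
  have hct : t / K ≤ t := div_le_self ht0.le hK1
  have htK : t = t / K * K := by field_simp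
  have hsum : μ 0 b + μ 0 (!b) = 1 := by
    have := hμ1 0; rw [Fintype.sum_bool] at this; cases b <;> simp <;> linarith
  have hμb := hμ 0 b
  have hμb' := hμ 0 (!b)
  have hS : 0 < (1 - t) * w 0 + 2 * t := by linarith
  -- the common rate `ρ = p·c/(192(h+2t))`
  have hp : 0 < μ 0 b + μ 0 (!b) * rr := by have := mul_nonneg hμb'.le hrr0; linarith
  have hp1 : μ 0 b + μ 0 (!b) * rr ≤ 1 := by have := mul_le_mul_of_nonneg_left hrr1 hμb'.le; linarith
  have hρ0 : 0 < (μ 0 b + μ 0 (!b) * rr) * (t / K) / (192 * ((1 - t) * w 0 + 2 * t)) := div_pos (mul_pos hp hc0) (by linarith)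
  have hρ1 : (μ 0 b + μ 0 (!b) * rr) * (t / K) / (192 * ((1 - t) * w 0 + 2 * t)) ≤ 1 := by
    rw [div_le_one (by linarith)]
    have : (μ 0 b + μ 0 (!b) * rr) * (t / K) ≤ 1 * t := mul_le_mul hp1 hct hc0.le (by norm_num)
    linarith
  -- comparison of rates: `ρ ≤ ρ'` whenever `a·192 ≥ p·k` for `ρ' = a·c/(k(h+2t))`
  have cmp : ∀ a k : ℝ, 0 < k → (μ 0 b + μ 0 (!b) * rr) * k ≤ 192 * a →
      (μ 0 b + μ 0 (!b) * rr) * (t / K) / (192 * ((1 - t) * w 0 + 2 * t)) ≤ a * (t / K) / (k * ((1 - t) * w 0 + 2 * t)) := by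
    intro a k hk hak
    rw [div_le_div_iff₀ (by positivity) (by positivity)]
    have := mul_le_mul_of_nonneg_right hak (mul_pos hc0 hS).le
    linarith
  -- weakening of a drift inequality to the common rate
  have weaken : ∀ {ρ' : ℝ} {φ : ℝ → ℝ}, (μ 0 b + μ 0 (!b) * rr) * (t / K) / (192 * ((1 - t) * w 0 + 2 * t)) ≤ ρ' → (∀ n : ℤ, 0 ≤ φ n) →
      (∀ B₁ B₂ : ℕ, B₁ + 1 ≤ B₂ → B₂ ≤ K →
        ρ' * ((B₂ : ℝ) - B₁ + φ B₁ + φ B₂) ≤ μ 0 b * (πb B₂ - πb B₁) + μ 0 (!b) * (πb' B₁ - πb' B₂)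
          + (μ 0 b * πb B₁ * (φ B₁ - φ (B₁ - 1)) - μ 0 (!b) * πb' B₁ * (φ (B₁ + 1) - φ B₁))
          + (μ 0 b * πb B₂ * (φ B₂ - φ (B₂ - 1)) - μ 0 (!b) * πb' B₂ * (φ (B₂ + 1) - φ B₂))) →
      ∀ B₁ B₂ : ℕ, B₁ + 1 ≤ B₂ → B₂ ≤ K →
        (μ 0 b + μ 0 (!b) * rr) * (t / K) / (192 * ((1 - t) * w 0 + 2 * t)) * ((B₂ : ℝ) - B₁ + φ B₁ + φ B₂)
          ≤ μ 0 b * (πb B₂ - πb B₁) + μ 0 (!b) * (πb' B₁ - πb' B₂)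
          + (μ 0 b * πb B₁ * (φ B₁ - φ (B₁ - 1)) - μ 0 (!b) * πb' B₁ * (φ (B₁ + 1) - φ B₁))
          + (μ 0 b * πb B₂ * (φ B₂ - φ (B₂ - 1)) - μ 0 (!b) * πb' B₂ * (φ (B₂ + 1) - φ B₂)) := by
    intro ρ' φ hle hφ0 h B₁ B₂ h12 h2K
    have hX : 0 ≤ (B₂ : ℝ) - B₁ + φ B₁ + φ B₂ := by
      have a1 := hφ0 B₁; have a2 := hφ0 B₂; push_cast at a1 a2
      have : (B₁ : ℝ) + 1 ≤ B₂ := by exact_mod_cast h12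
      linarith
    exact le_trans (mul_le_mul_of_nonneg_right hle hX) (h B₁ B₂ h12 h2K)
  -- the three legs
  have legs : ∃ φ : ℝ → ℝ, (∀ n : ℤ, 0 ≤ φ n) ∧ (∀ n n' : ℤ, |φ n - φ n'| ≤ |(n : ℝ) - n'|) ∧ (∀ n : ℕ, n ≤ K → φ n ≤ (K : ℝ)) ∧
      ∀ B₁ B₂ : ℕ, B₁ + 1 ≤ B₂ → B₂ ≤ K →
        (μ 0 b + μ 0 (!b) * rr) * (t / K) / (192 * ((1 - t) * w 0 + 2 * t)) * ((B₂ : ℝ) - B₁ + φ B₁ + φ B₂)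
          ≤ μ 0 b * (πb B₂ - πb B₁) + μ 0 (!b) * (πb' B₁ - πb' B₂)
          + (μ 0 b * πb B₁ * (φ B₁ - φ (B₁ - 1)) - μ 0 (!b) * πb' B₁ * (φ (B₁ + 1) - φ B₁))
          + (μ 0 b * πb B₂ * (φ B₂ - φ (B₂ - 1)) - μ 0 (!b) * πb' B₂ * (φ (B₂ + 1) - φ B₂)) := by
    by_cases hsmall : μ 0 (!b) * rr * K ≤ μ 0 b / 2
    · ---------------------------------------------------------------- small pool: `φ = max{x,0}`, rate `μ c/(2(h+2t))`
      have hφ0 : ∀ n : ℤ, 0 ≤ max (n : ℝ) 0 := fun n => le_max_right _ _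
      refine ⟨fun x => max x 0, hφ0, fun n n' => abs_max_sub_max_le_abs _ _ 0, fun n hn => ?_, ?_⟩
      · show max (n : ℝ) 0 ≤ K
        rw [max_eq_left (Nat.cast_nonneg _)]; exact_mod_cast hn
      have hle : (μ 0 b + μ 0 (!b) * rr) * (t / K) / (192 * ((1 - t) * w 0 + 2 * t)) ≤ μ 0 b * (t / K) / (2 * ((1 - t) * w 0 + 2 * t)) := by
        apply cmp _ _ (by norm_num)
        -- `μ̄ rr ≤ μ̄ rr K ≤ μ/2`, so `p ≤ 3μ/2`
        have : μ 0 (!b) * rr ≤ μ 0 (!b) * rr * K := by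
          have := mul_le_mul_of_nonneg_left hK1 (mul_nonneg hμb'.le hrr0); linarith
        linarith
      exact weaken (φ := fun x => max x 0) hle hφ0 (fun B₁ B₂ h12 h2K => oneCopyDrift_smallPool (φ := fun x => max x 0) hh0 hc0 hct htK hrr0 hrr1 hμb.le hμb'.le hsmall
        (fun B => rfl) (fun B => rfl) (fun x => rfl) rfl B₁ B₂ h12 (by exact_mod_cast h2K))
    · have hpool : μ 0 b / 2 ≤ μ 0 (!b) * rr * K := by linarith
      by_cases hrrμ : rr ≤ μ 0 b
      · -------------------------------------------------------------- macroscopic pool: the relative-drift potential, rate `μ c/(96(h+2t))`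
        obtain ⟨φ, hφ0, hφ, hφm, h1D⟩ := oneCopyDrift_macroPool (πb := πb) (πb' := πb') hh0 hc0 hct htK hK1n hrr0 hrr1 hμb hμb'.le hsum hrrμ hpool
          (fun B => rfl) (fun B => rfl)
        refine ⟨φ, hφ0, hφ, hφm, ?_⟩
        have hle : (μ 0 b + μ 0 (!b) * rr) * (t / K) / (192 * ((1 - t) * w 0 + 2 * t)) ≤ μ 0 b * (t / K) / (96 * ((1 - t) * w 0 + 2 * t)) := by
          apply cmp _ _ (by norm_num)
          have : μ 0 (!b) * rr ≤ μ 0 b := by have := mul_le_mul_of_nonneg_left hrrμ hμb'.le; nlinarith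
          linarith
        exact weaken (φ := φ) hle hφ0 h1D
      · -------------------------------------------------------------- weak drift `rr > μ`: `φ ≡ 0`, rate `c(ph + rr t)/(h+2t)²`
        have hrrμ' : μ 0 b ≤ rr := by linarith
        have hφ0 : ∀ n : ℤ, (0 : ℝ) ≤ 0 := fun n => le_rfl
        refine ⟨fun _ => 0, hφ0, fun n n' => by simp, fun n hn => by positivity, ?_⟩
        have hle : (μ 0 b + μ 0 (!b) * rr) * (t / K) / (192 * ((1 - t) * w 0 + 2 * t))
            ≤ (t / K) * (μ 0 b * ((1 - t) * w 0 + rr * t) + μ 0 (!b) * rr * ((1 - t) * w 0 + t)) / ((1 - t) * w 0 + 2 * t) ^ 2 := by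
          rw [div_le_div_iff₀ (by positivity) (by positivity)]
          -- `p(h+2t) ≤ 192(ph + rr t)` since `p ≤ 2rr`
          have e1 : μ 0 b * rr * t + μ 0 (!b) * rr * t = rr * t := by rw [← add_mul, ← add_mul, hsum, one_mul]
          have p2 : (μ 0 b + μ 0 (!b) * rr) * t ≤ 96 * (rr * t) := by
            have : μ 0 b + μ 0 (!b) * rr ≤ 96 * rr := by
              have := mul_le_mul_of_nonneg_left hrr1 hμb'.le; nlinarith
            exact le_trans (mul_le_mul_of_nonneg_right this ht0.le) (by linarith)
          have key : (μ 0 b + μ 0 (!b) * rr) * ((1 - t) * w 0 + 2 * t)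
              ≤ 192 * (μ 0 b * ((1 - t) * w 0 + rr * t) + μ 0 (!b) * rr * ((1 - t) * w 0 + t)) := by
            have : 0 ≤ (μ 0 b + μ 0 (!b) * rr) * ((1 - t) * w 0) := by positivity
            nlinarith [e1, p2, this, mul_nonneg hμb'.le hrr0, hh0.le]
          have := mul_le_mul_of_nonneg_left key (mul_pos hc0 hS).le
          nlinarith [this]
        exact weaken (φ := fun _ => 0) hle hφ0 (fun B₁ B₂ h12 h2K => oneCopyDrift_zero (φ := fun _ => 0) hh0 hc0 hct htK hrr0 hrr1 hμb.le hμb'.le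
          (fun B => rfl) (fun B => rfl) (fun x => rfl) rfl B₁ B₂ h12 (by exact_mod_cast h2K))
  obtain ⟨φ, hφ0, hφ, hφm, h1D⟩ := legs
  exact boolStar_mixingTime_le_of_oneCopyDrift_int κ hm ht0 ht1 hw0 hw00 hw1 hμ hμ1 hM0 hidle hhom hunif hb (rr := rr) rfl hφ0 hφ hφm
    (πb := πb) (πb' := πb') (fun B => rfl) (fun B => rfl) hρ0 hρ1 h1D hε

/-- **THE SAME LAW WITH THE CONSTANT PULLED OUT: `t_mix(ε) ≤ ⌈768·K·(h+2t)/(p·h·t)·log((3eK+1)/ε)⌉₊`**, `h = (1−t)w_0`, `p = μ_0(b) + μ_0(b̄)rr`.  In particular at ANY FIXED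
swap fraction (say `t = 1/3`, `w_0 = 1`: `h = 2/3`, `768K(h+2t)/(p·h·t) = 4608·K/p`) the homogeneous Boolean star mixes in `O((K/p)·log(K/ε))` steps — the order `K/p` of
OPEN-MATH item 5 at a `p`-INDEPENDENT swap fraction, for every law. [ours] -/
theorem boolStar_mixingTime_le_lawFree' (hm : 1 ≤ m) (ht0 : 0 < t) (ht1 : t < 1) (hw0 : ∀ k, 0 ≤ w k) (hw00 : 0 < w 0)
    (hw1 : ∑ k, w k = 1) (hμ : ∀ k x, 0 < μ k x) (hμ1 : ∀ k, ∑ u, μ k u = 1) (hM0 : ∀ u v, M 0 u v = μ 0 v)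
    (hidle : ∀ i : Fin K, ∀ u v, M i.succ u v = if v = u then 1 else 0) (hhom : ∀ i : Fin K, μ i.succ = μ 1)
    {c0 : ℕ} (hunif : ∀ i : Fin K, (univ.filter fun r : Fin m => κ r = i).card = c0)
    {b : Bool} (hb : μ 0 b * μ 1 (!b) ≤ μ 0 (!b) * μ 1 b)
    {ε : ℝ} (hε : 0 < ε) :
    mixingTime (fun y z : Fin (K + 1) → Bool =>
        t * ptGraphSwap μ (fun r : Fin m => (((0 : Fin (K + 1)), (κ r).succ) : Fin (K + 1) × Fin (K + 1))) (fun _ : Fin m => Equiv.refl Bool) y z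
          + (1 - t) * prodKernel w M y z) (tensorFun μ) ε
      ≤ ⌈768 * K * ((1 - t) * w 0 + 2 * t) / ((μ 0 b + μ 0 (!b) * (μ 0 b * μ 1 (!b) / (μ 0 (!b) * μ 1 b))) * ((1 - t) * w 0) * t)
          * Real.log ((Real.exp 1 * (K + 2 * K) + 1) / ε)⌉₊ := by
  have main := boolStar_mixingTime_le_lawFree κ hm ht0 ht1 hw0 hw00 hw1 hμ hμ1 hM0 hidle hhom hunif hb hε
  have hmK : (m : ℝ) = c0 * K := uniformList_card κ hunif
  have hK0 : (K : ℝ) ≠ 0 := by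
    intro h0
    have : (m : ℝ) = 0 := by rw [hmK, h0]; simp
    exact absurd (by exact_mod_cast this : m = 0) (by omega)
  have hh0 : (1 - t) * w 0 ≠ 0 := (mul_pos (by linarith) hw00).ne'
  have hS : (1 - t) * w 0 + 2 * t ≠ 0 := by have := mul_pos (show (0:ℝ) < 1 - t by linarith) hw00; linarith
  have hp : μ 0 b + μ 0 (!b) * (μ 0 b * μ 1 (!b) / (μ 0 (!b) * μ 1 b)) ≠ 0 := by
    have : 0 ≤ μ 0 (!b) * (μ 0 b * μ 1 (!b) / (μ 0 (!b) * μ 1 b)) := by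
      have := hμ 0 b; have := hμ 0 (!b); have := hμ 1 b; have := hμ 1 (!b); positivity
    linarith [hμ 0 b]
  have e : 1 / ((1 - t) * w 0 * ((μ 0 b + μ 0 (!b) * (μ 0 b * μ 1 (!b) / (μ 0 (!b) * μ 1 b))) * (t / K) / (192 * ((1 - t) * w 0 + 2 * t))) / 4)
      = 768 * K * ((1 - t) * w 0 + 2 * t) / ((μ 0 b + μ 0 (!b) * (μ 0 b * μ 1 (!b) / (μ 0 (!b) * μ 1 b))) * ((1 - t) * w 0) * t) := by
    field_simp
    ring
  rw [e] at main
  exact main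

/-- **THE HALF-SWAP CARD, EVERY LAW: `t_mix(ε) ≤ ⌈(4608·K/p)·log((3eK+1)/ε)⌉₊`** for the homogeneous Boolean star at swap fraction `t = 1/2` with `w_0 = 1` (the hub is
redrawn at every idle step), `p = μ_0(b) + μ_0(b̄)rr` — `O((K/p)·log(K/ε))` with an absolute constant, to be read against the half-swap floor `(2K/p)·log((K+1)(1−ε−Kθ))` of
chapter O on the witness family (`Scaling/HalfSwapBooleanStarLaw`). [ours] -/
theorem halfBoolStar_mixingTime_le_lawFree (hm : 1 ≤ m) (hw0 : ∀ k, 0 ≤ w k) (hw01 : w 0 = 1)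
    (hw1 : ∑ k, w k = 1) (hμ : ∀ k x, 0 < μ k x) (hμ1 : ∀ k, ∑ u, μ k u = 1) (hM0 : ∀ u v, M 0 u v = μ 0 v)
    (hidle : ∀ i : Fin K, ∀ u v, M i.succ u v = if v = u then 1 else 0) (hhom : ∀ i : Fin K, μ i.succ = μ 1)
    {c0 : ℕ} (hunif : ∀ i : Fin K, (univ.filter fun r : Fin m => κ r = i).card = c0)
    {b : Bool} (hb : μ 0 b * μ 1 (!b) ≤ μ 0 (!b) * μ 1 b)
    {ε : ℝ} (hε : 0 < ε) :
    mixingTime (fun y z : Fin (K + 1) → Bool =>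
        (1 / 2 : ℝ) * ptGraphSwap μ (fun r : Fin m => (((0 : Fin (K + 1)), (κ r).succ) : Fin (K + 1) × Fin (K + 1))) (fun _ : Fin m => Equiv.refl Bool) y z
          + (1 - 1 / 2) * prodKernel w M y z) (tensorFun μ) ε
      ≤ ⌈4608 * K / (μ 0 b + μ 0 (!b) * (μ 0 b * μ 1 (!b) / (μ 0 (!b) * μ 1 b))) * Real.log ((Real.exp 1 * (K + 2 * K) + 1) / ε)⌉₊ := by
  have main := boolStar_mixingTime_le_lawFree' κ hm (by norm_num : (0 : ℝ) < 1 / 2) (by norm_num) hw0 (by rw [hw01]; norm_num) hw1 hμ hμ1 hM0 hidle hhom hunif hb hε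
  have hp : μ 0 b + μ 0 (!b) * (μ 0 b * μ 1 (!b) / (μ 0 (!b) * μ 1 b)) ≠ 0 := by
    have : 0 ≤ μ 0 (!b) * (μ 0 b * μ 1 (!b) / (μ 0 (!b) * μ 1 b)) := by
      have := hμ 0 b; have := hμ 0 (!b); have := hμ 1 b; have := hμ 1 (!b); positivity
    linarith [hμ 0 b]
  have e : (768 : ℝ) * K * ((1 - 1 / 2) * w 0 + 2 * (1 / 2)) / ((μ 0 b + μ 0 (!b) * (μ 0 b * μ 1 (!b) / (μ 0 (!b) * μ 1 b))) * ((1 - 1 / 2) * w 0) * (1 / 2))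
      = 4608 * K / (μ 0 b + μ 0 (!b) * (μ 0 b * μ 1 (!b) / (μ 0 (!b) * μ 1 b))) := by
    rw [hw01, div_eq_div_iff (by norm_num [hp]) hp]
    ring
  rw [e] at main
  exact main

end Law

end Summit.Ventures.LatticeQCDFlow.Scaling

end
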